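import Summits.QuantumFields.BalabanUV.T4Continuum.Support.NE7CurvedSupLetterData
import Summits.QuantumFields.BalabanUV.T4Continuum.Support.NE7FlatSupLetterCompact
import Summits.QuantumFields.BalabanUV.T4Continuum.Support.NE7SliceStepContraction
import HarnessLib

/-!
# NE7CurvedSupLetterBootstrap — THE BOOTSTRAP AT A POINT FOR THE CURVED SUP LETTER (L): for `Y ∈ 𝒯_E(W)`, any point `(y₀, κ₀)`, any cut-off scale `K_b`, the compactly supported flat letter
# (`NE7FlatSupLetterCompact.sup_flat_compact`) applied to the cut-off gauged slice element `χ•Y^u` (data: `NE7CurvedSupLetterData`) reads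
# `‖Y(y₀,κ₀)‖ ≤ M·(K·(B + 16δS + 2g₁S) + K′·D_Z) + K″·w_Z∕M` with `D_Z`, `w_Z` displayed — in the B1 regime and the oscillation regime (memo ROAD-G100 §4; ROAD-G101 §6)

Cell `pub-balaban`, rung (B)+1 sub-cell t4, lineage `b2b-balaban-t4-ne7-p1`, generation 101 (CRUX PROVER NE7 #1 = OWNER of BINDER row NE7).  Objects: `M = L^{k+1}`, corner `blk_M y₀ − C₃·𝟙`
(`C₃ = K_b + nbRad + 3`), gauge `u = btree M W (corner)`, cut-off `χ = AveragingDeficitLatticeH2Prep.chi 0 (M·K_b) y₀`, `δ = (d+1)·2MC₃·x`, `g₁ = 1∕(MK_b)`, Lagrange-multiplier size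
`G = 2(2(d+1) + 4(d+1)d·M²x)S∕M` (`NE7EnergySliceDivergenceSup.divergence_sup_le`), level sum `σ = Σ_{i≤k}(L^iδ + 2loopRad(x_i))`.  The absorption (choice of `K_b`, `ε₀`) is `NE7CurvedSupLetter`.
WHAT ([folklore]; 0 def, 0 sorry; dimension `d + 1 ≥ 2`, `L ≥ 2`).  **`bootstrap_at_point`** (constants `K, K′, K″` existential = those of `sup_flat_compact`).
HONEST FRAMING (page 1): bookkeeping BY NAME; nothing of Bałaban's asserted; NOT yet (L) (no absorption here), NOT (S1), NOT NE7; spine 0∕9; finite T⁴ rung (B)+1 — NOT infinite volume, NOT mass gap,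
NOT BetaPertH, NOT Clay.  Continuum YM on T⁴ ⇐ BetaPertH ∧ nine spine estimates (0/9 proved); BetaPertH ⇐ (D1) ∧ (D4) ∧ CAP+tail; G-an2-4 gates asym, D1 and NE2/3/4.
-/

set_option autoImplicit false

open scoped BigOperators Matrix.Norms.L2Operator
open Finset

namespace Summit.QuantumFields.BalabanUV.T4Continuum.NE7CurvedSupLetterBootstrap

open Literature.MathematicalPhysics.QuantumFieldTheory.Balaban1983to89
open B7Prop1Explicit B7Prop2Explicit
open T4AveragingDeficitWall (IsUnitaryCfg IsSkewDir SmallField Ad curlAt box)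
open T4AveragingDeficitWallBoundary (IsPeriodicCfg periodBox)
open AveragingDeficitPeriodicCounting (IsPeriodicDir)
open AveragingDeficitCounting (mem_box_iff self_mem_box)
open AveragingDeficitTransport (norm_Ad_of_unitary)
open AveragingDeficitMultiLevelPrep (LevelSmall tower)
open AveragingDeficitTwoLevelPrep (prop1Radius)
open AveragingDeficitLocality (dirGauge)
open AveragingDeficitBlockDensity (btree btree_mem)
open AveragingDeficitLatticeH2Prep (chi chi_nonneg chi_le_one chi_eq_one_of_mem chi_eq_zero_of_not_mem abs_chi_sub_chi_le_of_step)
open SpreadLift (loopRad)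
open BlockAverageVaryHolo (nbRad)
open BlockAveragePushDirSplit (flat)
open NE3CoercivityScaling (flatDiv)
open NE3CovariantWeitzenbock (covDiv)
open NE3CovariantLineSumsError (Csup Csup_nonneg iterate_prop1Radius_nonneg)
open NE3TangentCovariantTower (QbarIter)
open NE3QbarIterCovLiftPrep (sum_pow_le_pow_real sum_loopRad_iterate_le)
open NE3TopRadiusLetters (loopRad_iterate_le_of_levelSmall)
open SmoothRefineBlocks (blk res blk_add_res res_nonneg res_le)
open NE7MeanZeroGaugeSliceW (energyBlockLandauW)
open NE7EnergySliceLocalForm (covDiv_eq_nestedExt_of_mem)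
open NE7EnergySliceDivergenceSup (divergence_sup_le)
open NE7LocalStraightDatumLetter (norm_dirGauge_le)
open NE7CurvedSupLetterData (comb_near_flat ball_near_flat curl_datum div_datum_uniform straight_datum_uniform support_of_cutoff)
open NE7FlatSupLetterCompact (sup_flat_compact)
open NE7SliceStepContraction (exists_bond_max)

noncomputable section

variable {d : ℕ} {n : Type*} [Fintype n] [DecidableEq n]

set_option maxHeartbeats 800000 in
/-- **THE BOOTSTRAP AT A POINT** (dimension `d + 1 ≥ 2`): with the constants `K, K′, K″` of `NE7FlatSupLetterCompact.sup_flat_compact`, for every `L ≥ 2`, `k`, `N`, every unitary `W` of period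
`tower L N (k+1)` in the class with `SmallField W x`, every `Y ∈ 𝒯_E(W)` with `‖Y‖ ≤ S` and `‖curl_W Y‖ ≤ B` off the diagonal, every point `(y₀, κ₀)`, every cut-off scale `K_b ≥ 1` (with
`C₃ = K_b + nbRad + 3`, `δ = (d+1)·2MC₃·x`, `g₁ = 1∕(MK_b)`, the Lagrange-multiplier size `G`, the level sum `σ`), in the B1 regime `hθ` and the oscillation regime `hσ`:
`‖Y(y₀,κ₀)‖ ≤ M·(K·(B + 16δS + 2g₁S) + K′·D_Z) + K″·w_Z∕M` with the divergence and straight data `D_Z`, `w_Z` displayed. [folklore] -/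
theorem bootstrap_at_point [Nonempty n] (hd : 1 ≤ d) :
    ∃ K : ℝ, 0 < K ∧ ∃ K' : ℝ, 0 < K' ∧ ∃ K'' : ℝ, 0 < K'' ∧ ∀ {L : ℕ}, 2 ≤ L → ∀ (k N : ℕ) [NeZero N] (W : Site (d + 1) → Fin (d + 1) → (Matrix n n ℂ)ˣ) (x : ℝ),
      IsUnitaryCfg W → IsPeriodicCfg W ((tower L N (k + 1) : ℕ) : ℤ) → 0 ≤ x → LevelSmall (d + 1) L k x → SmallField W x →
      ∀ Y ∈ energyBlockLandauW (d := d + 1) (n := n) L N (k + 1) W, ∀ (B : ℝ), 0 ≤ B →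
        (∀ (z : Site (d + 1)) (μ ν : Fin (d + 1)), μ ≠ ν → ‖curlAt W Y z μ ν‖ ≤ B) →
      ∀ (S : ℝ), 0 ≤ S → (∀ w μ, ‖Y w μ‖ ≤ S) → ∀ (y₀ : Site (d + 1)) (κ₀ : Fin (d + 1)) (Kb C₃ : ℕ), 1 ≤ Kb → C₃ = Kb + nbRad (d + 1) L + 3 →
      ∀ (δs g₁ G σs : ℝ), δs = (((d + 1 : ℕ) : ℝ) * ((((2 * (L ^ (k + 1) * C₃) + 1 : ℕ) : ℝ)) - 1)) * x → g₁ = 1 / ((L ^ (k + 1) * Kb : ℕ) : ℝ) →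
      G = 2 * (2 * ((d + 1 : ℕ) : ℝ) + 4 * ((d + 1 : ℕ) : ℝ) * ((((d + 1 : ℕ) : ℝ)) - 1) * (((L : ℝ) ^ (k + 1)) ^ 2 * x)) * S / (L : ℝ) ^ (k + 1) →
      σs = ∑ i ∈ Finset.range (k + 1), ((L : ℝ) ^ i * δs + 2 * loopRad (d + 1) L ((prop1Radius (d + 1) L)^[i] x)) →
      4 * (((d + 1 : ℕ) : ℝ)) ^ 2 * ((L : ℝ) ^ (k + 1) - 1) ^ 2 * x + 16 * ((d + 1 : ℕ) : ℝ) * loopRad (d + 1) L ((prop1Radius (d + 1) L)^[k] x) ≤ 1 / 2 →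
      2 * ((((d + 1 : ℕ) : ℝ)) * ((L : ℝ) - 1)) * σs ≤ 1 / 2 →
      ‖Y y₀ κ₀‖ ≤ (L : ℝ) ^ (k + 1) * (K * (B + 16 * δs * S + 2 * g₁ * S)
          + K' * (((d + 1 : ℕ) : ℝ) * g₁ * S + (((d + 1 : ℕ) : ℝ) * (2 * δs * S) + 4 * ((((d + 1 : ℕ) : ℝ)) * ((L : ℝ) - 1)) * σs * G)
            + (((L ^ (k + 1) - 1 : ℕ)) : ℝ) * g₁ * G))
        + K'' * (((L ^ (k + 1) : ℕ) : ℝ) * ((((2 * (L ^ (k + 1) - 1) : ℕ)) : ℝ) * g₁ * S)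
          + (L : ℝ) ^ k * (2 * S) * ((2 * (((d + 1 : ℕ) : ℝ)) + 4) * (L : ℝ) ^ 2 * ((L : ℝ) ^ (k + 1) * δs)
            + (2 * ((2 * (((d + 1 : ℕ) : ℝ)) + 4) * (L : ℝ) ^ 2) + (8 * (L : ℝ) + Csup (d + 1) L))
              * (4 / 3 * (17 * (((((d + 1 : ℕ) : ℝ)) + 1) * ((((d + 1 : ℕ) : ℝ)) + 4)) * (((L : ℝ) ^ (k + 1)) ^ 2 * x))))) / (L : ℝ) ^ (k + 1) := by
  obtain ⟨K, hK, K', hK', K'', hK'', hflat⟩ := sup_flat_compact (d := d) (n := n)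
  refine ⟨K, hK, K', hK', K'', hK'', ?_⟩
  intro L hL k N _ W x hWu hWP hx hs hWx Y hY B hB0 hB S hS0 hS y₀ κ₀ Kb C₃ hKb1 hC₃ δs g₁ G σs hδs hg₁ hGdef hσs hθ hσ
  have hL1 : 1 ≤ L := by omega
  haveI : NeZero L := ⟨by omega⟩
  have hM1 : 1 ≤ L ^ (k + 1) := Nat.one_le_pow _ _ hL1
  have hMz : ((L ^ (k + 1) : ℕ) : ℤ) = (L : ℤ) ^ (k + 1) := by push_cast; ring
  have hMz1 : (1 : ℤ) ≤ ((L ^ (k + 1) : ℕ) : ℤ) := by exact_mod_cast hM1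
  -- the objects
  obtain ⟨u, hu⟩ : ∃ u : Site (d + 1) → (Matrix n n ℂ)ˣ, u = btree (L ^ (k + 1)) W (fun i => blk (L ^ (k + 1)) y₀ i - (C₃ : ℤ)) := ⟨_, rfl⟩
  have huu : ∀ w, u w ∈ unitaryUnits (Matrix n n ℂ) := fun w => by rw [hu]; exact btree_mem hWu _ _ w
  obtain ⟨χ, hχ⟩ : ∃ χ : Site (d + 1) → ℝ, χ = chi 0 (L ^ (k + 1) * Kb) y₀ := ⟨_, rfl⟩
  have hS' : ∀ w μ, ‖dirGauge u Y w μ‖ ≤ S := fun w μ => norm_dirGauge_le huu Y hS w μ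
  -- the cut-off: values in `[0,1]`, `χ(y₀) = 1`, support, Lipschitz
  have hMKb1 : 1 ≤ L ^ (k + 1) * Kb := Nat.mul_pos (by omega) (by omega)
  have hχ1 : ∀ w, |χ w| ≤ 1 := fun w => by
    rw [hχ, abs_le]; exact ⟨by linarith only [chi_nonneg 0 (L ^ (k + 1) * Kb) y₀ w], chi_le_one _ _ _ _⟩
  have hχy₀ : χ y₀ = 1 := by rw [hχ]; exact chi_eq_one_of_mem (self_mem_box 0 y₀)
  have hg₁0 : 0 ≤ g₁ := by rw [hg₁]; positivity
  have hstep : ∀ x₁ x₂ : Site (d + 1), (∀ j, |x₂ j - x₁ j| ≤ 1) → |χ x₂ - χ x₁| ≤ g₁ := fun x₁ x₂ h => by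
    rw [hχ, hg₁]; exact abs_chi_sub_chi_le_of_step hMKb1 h
  have hMKbz : ((L ^ (k + 1) * Kb : ℕ) : ℤ) = ((L ^ (k + 1) : ℕ) : ℤ) * Kb := by push_cast; ring
  have hsuppχ : ∀ w, χ w ≠ 0 → ∀ i, |w i - y₀ i| ≤ ((L ^ (k + 1) : ℕ) : ℤ) * Kb := by
    intro w hw
    by_contra hc
    push Not at hc
    obtain ⟨i, hi⟩ := hc
    apply hw
    rw [hχ]
    refine chi_eq_zero_of_not_mem hMKb1 (fun hmem => ?_)
    rw [zero_add] at hmem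
    have := (mem_box_iff.mp hmem) i
    rw [hMKbz] at this
    linarith only [this, hi]
  -- THE NEAR-FLATNESS OF THE COMB GAUGE ON THE WORKING REGION
  have hδs0 : 0 ≤ δs := by
    rw [hδs]
    refine mul_nonneg (mul_nonneg (by positivity) ?_) hx
    have : (1 : ℝ) ≤ (((2 * (L ^ (k + 1) * C₃) + 1 : ℕ)) : ℝ) := by exact_mod_cast (by omega : 1 ≤ 2 * (L ^ (k + 1) * C₃) + 1)
    linarith
  have hMnb : (0 : ℤ) ≤ ((L ^ (k + 1) : ℕ) : ℤ) * (nbRad (d + 1) L) := by positivity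
  -- (i) within sup-distance 1 of the support of `χ`
  have hnear1 : ∀ z : Site (d + 1), χ z ≠ 0 → ∀ w : Site (d + 1), (∀ i, |w i - z i| ≤ 1) →
      ∀ ν, ‖((gaugeAct u W w ν : (Matrix n n ℂ)ˣ) : Matrix n n ℂ) - 1‖ ≤ δs := by
    intro z hz w hw ν
    rw [hu, hδs]
    refine comb_near_flat hM1 hWu hx hWx y₀ Kb (nbRad (d + 1) L) C₃ hC₃ w 1 (fun i => ?_) (by linarith only [hMz1, hMnb]) ν
    have a := abs_le.mp (hsuppχ z hz i); have b := abs_le.mp (hw i)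
    rw [abs_le]; constructor <;> linarith only [a.1, a.2, b.1, b.2]
  -- (ii) at the points of the support
  have hWq : ∀ xp : Site (d + 1), χ xp ≠ 0 → ∀ μ, ‖((gaugeAct u W xp μ : (Matrix n n ℂ)ˣ) : Matrix n n ℂ) - 1‖ ≤ δs :=
    fun xp hxp μ => hnear1 xp hxp xp (fun i => by simp) μ
  -- (iii) on the fine balls of the blocks of support points
  have hballsupp : ∀ xp : Site (d + 1), χ xp ≠ 0 → ∀ (x' : Site (d + 1)) (μ : Fin (d + 1)),
      l1 (x' - ((L : ℤ) ^ (k + 1)) • blk (L ^ (k + 1)) xp) ≤ nbRad (d + 1) L * ∑ i ∈ Finset.range (k + 1), L ^ i →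
      ‖((gaugeAct u W x' μ : (Matrix n n ℂ)ˣ) : Matrix n n ℂ) - 1‖ ≤ δs := by
    intro xp hxp x' μ hx'
    rw [hu, hδs]
    refine ball_near_flat hL k hWu hx hWx y₀ Kb C₃ hC₃ (blk (L ^ (k + 1)) xp) (fun i => ?_) x' hx' μ
    have a := abs_le.mp (hsuppχ xp hxp i)
    have hb := congr_fun (blk_add_res (L ^ (k + 1)) xp) i
    simp only [Pi.add_apply, Pi.smul_apply, smul_eq_mul] at hb
    have h0 := res_nonneg hM1 xp i
    have h1 := res_le hM1 xp i
    rw [abs_le]; constructor <;> linarith only [a.1, a.2, hb, h0, h1, hMz1]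
  -- (iv) on the fine balls of the blocks whose straight-average region meets the support
  have hballχ : ∀ (zc : Site (d + 1)) (κ' : Fin (d + 1)), (∃ x' : Site (d + 1), (((L ^ (k + 1) : ℕ) : ℤ) • zc) ≤ x' ∧
        (∀ i, i ≠ κ' → x' i ≤ ((((L ^ (k + 1) : ℕ) : ℤ) • zc) i) + (((L ^ (k + 1) : ℕ) : ℤ) - 1)) ∧
        x' κ' ≤ ((((L ^ (k + 1) : ℕ) : ℤ) • zc) κ') + 2 * (((L ^ (k + 1) : ℕ) : ℤ) - 1) ∧ χ x' ≠ 0) →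
      ∀ (x' : Site (d + 1)) (μ : Fin (d + 1)), l1 (x' - ((L : ℤ) ^ (k + 1)) • zc) ≤ nbRad (d + 1) L * ∑ i ∈ Finset.range (k + 1), L ^ i →
        ‖((gaugeAct u W x' μ : (Matrix n n ℂ)ˣ) : Matrix n n ℂ) - 1‖ ≤ δs := by
    intro zc κ' hex x' μ hx'
    obtain ⟨x'', h1, h2, h3, h4⟩ := hex
    rw [hu, hδs]
    refine ball_near_flat hL k hWu hx hWx y₀ Kb C₃ hC₃ zc (fun i => ?_) x' hx' μ
    have a := abs_le.mp (hsuppχ x'' h4 i)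
    have hlo := h1 i
    simp only [Pi.smul_apply, smul_eq_mul] at hlo h2 h3
    have hhi : x'' i ≤ ((L ^ (k + 1) : ℕ) : ℤ) * zc i + 2 * (((L ^ (k + 1) : ℕ) : ℤ) - 1) := by
      by_cases hi : i = κ'
      · subst hi; exact h3
      · have := h2 i hi; linarith only [this, hMz1]
    rw [abs_le]; constructor <;> linarith only [a.1, a.2, hlo, hhi, hMz1]
  -- THE LAGRANGE MULTIPLIER IS `O(S∕M)` (B1)
  obtain ⟨hgB, hGc⟩ := divergence_sup_le (d := d + 1) (by omega) hL k hWu hWP hx hs hWx hθ hY hS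
  have hgB' : ∀ b, ‖NE3CovariantBlockMean.bmeanIterW L (k + 1) W (covDiv W Y) b‖ ≤ G := fun b => by rw [hGdef]; exact hgB b
  have hGc' : ∀ w, ‖covDiv W Y w‖ ≤ G := fun w => by rw [hGdef]; exact hGc w
  have hG0 : 0 ≤ G := (norm_nonneg _).trans (hGc' 0)
  have hloc : ∀ w, covDiv W Y w = NE7NestedCovariantExtension.nestedExt L (k + 1) W (NE3CovariantBlockMean.bmeanIterW L (k + 1) W (covDiv W Y)) w :=
    fun w => covDiv_eq_nestedExt_of_mem hL1 k hWu hWP hx hs hWx hY w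
  -- THE THREE DATA OF `Z`
  have hcurlZ : ∀ (z : Site (d + 1)) (μ ν : Fin (d + 1)), μ ≠ ν →
      ‖curlAt (flat (d := d + 1) (n := n)) (fun w μ' => χ w • dirGauge u Y w μ') z μ ν‖ ≤ B + 16 * δs * S + 2 * g₁ * S :=
    fun z μ ν hne => curl_datum hWu huu Y χ hB0 hS0 hδs0 hB hS' hχ1 hstep hnear1 z μ ν hne
  have hdivZ := div_datum_uniform (d := d + 1) (by omega) hL k hWu hx hs hWx huu Y hloc hS hgB' hGc' hg₁0 hδs0 χ hχ1 hstep hσs hσ hWq hballsupp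
  have hQZ := straight_datum_uniform hL k hWu hx hs hWx huu Y χ hY.2.2.1 hS0 hS hχ1 hstep hg₁0 hδs0 hballχ
  -- THE COMPACTLY SUPPORTED FLAT LETTER on the cube `M•(blk y₀ − (K_b+6)𝟙) + [0, M(2K_b+12))`
  have hsupp : ∀ xp : Site (d + 1), (∃ i, ¬ (((L ^ (k + 1) : ℕ) : ℤ) * (fun i => blk (L ^ (k + 1)) y₀ i - ((Kb + 6 : ℕ) : ℤ)) i + 4 * ((L ^ (k + 1) : ℕ) : ℤ) ≤ xp i ∧
      xp i < ((L ^ (k + 1) : ℕ) : ℤ) * (fun i => blk (L ^ (k + 1)) y₀ i - ((Kb + 6 : ℕ) : ℤ)) i + ((L ^ (k + 1) : ℕ) : ℤ) * ((2 * Kb + 12 : ℕ) : ℤ) - 4 * ((L ^ (k + 1) : ℕ) : ℤ))) →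
      (fun w μ' => χ w • dirGauge u Y w μ') xp = 0 := by
    intro xp hxp
    rw [hχ]
    exact support_of_cutoff hM1 hKb1 y₀ (dirGauge u Y) xp hxp
  have hBZ0 : 0 ≤ B + 16 * δs * S + 2 * g₁ * S := by nlinarith only [hB0, hδs0, hS0, hg₁0]
  have key := hflat L hL k (fun i => blk (L ^ (k + 1)) y₀ i - ((Kb + 6 : ℕ) : ℤ)) (2 * Kb + 12) (by omega)
    (fun w μ' => χ w • dirGauge u Y w μ') hsupp (B + 16 * δs * S + 2 * g₁ * S) hBZ0 hcurlZ
    (fun b : Site (d + 1) => χ (((L ^ (k + 1) : ℕ) : ℤ) • b) • Ad (u (((L ^ (k + 1) : ℕ) : ℤ) • b)) (covDiv W Y (((L ^ (k + 1) : ℕ) : ℤ) • b)))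
    _ hdivZ _ hQZ y₀ κ₀
  -- READ AT `(y₀, κ₀)`: `‖Z(y₀,κ₀)‖ = S`
  have hZy₀ : ‖(fun w μ' => χ w • dirGauge u Y w μ') y₀ κ₀‖ = ‖Y y₀ κ₀‖ := by
    dsimp only
    rw [hχy₀, one_smul]
    exact norm_Ad_of_unitary (huu _) _
  rw [hZy₀] at key
  exact key

end

end Summit.QuantumFields.BalabanUV.T4Continuum.NE7CurvedSupLetterBootstrap
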